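import Mathlib
import HarnessLib
import Summits.HubbardSuperconductivity.HubbardSuperconductivity.Theorems.KLProgrammeC4aTubeTadpoleValue
import Summits.HubbardSuperconductivity.HubbardSuperconductivity.Theorems.KLProgrammeC4aOddPairing
import Summits.HubbardSuperconductivity.HubbardSuperconductivity.Theorems.KLProgrammeC4aCoMovingBridge
import Summits.HubbardSuperconductivity.HubbardSuperconductivity.Theorems.KLProgrammeC4aPathRigidity

/-!
# Route `KLProgramme` — crux C4a, S3 brick (B3, REPRESENTATION): the tube piece of the co-moving bubble is a level integral of «profile × loop-angle integral of
# Jacobian × (partner band)» — `θ` enters ONLY through `J(e, φ+θ)` and the partner band `ē(e,φ;ρ,ϑ,θ)`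

Cell `gate-hubbard-kl`, lane hubbard-kl-c4a-1 (g6); helper for stub (C) `stub_twoLeg_curvature` of the engine-flow child `KLRegimeEngineV17F2`
(stmt-HubbardSuperconductivity-20437); memo HOME/hubbard-kl-c4a-1/C4A-PLAN.md §24.4, §24.9 ((B3) plan, steps (ii)).  For a level profile `f` supported in the tube `(−r, r)` (the
loop line's propagator × tube cutoff, a function of `e_K(p)` only) and any smooth `Ψ` (the partner line's propagator as a function of ITS level), the tube piece of the
pp bubble read at the co-moving pair momentum `S_{ρ,ϑ,θ}(0) = Φ(0,θ) + Φ(ρ,ϑ+θ)` is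
`∫_{tube} f(e_K(p))·Ψ(e_K(S − p)) dp = ∫_{(−r,r)} f(e) · ∫_{(−π,π)} J(e, φ+θ)·Ψ(e_K(S_{ρ,ϑ,θ}(0) − Φ(e, φ+θ))) dφ de`
(`tubeTadpole_eq_setIntegral_angularAvg` of `…C4aTubeTadpoleValue` with the vertex `q ↦ Ψ(e_K(S − q))`, then the loop angle recentred at `θ` by `setIntegral_Ioc_two_pi_eq_recentre`);
the inner integrand is exactly `J(e,φ+θ)·Ψ(ē)` with the pp PARTNER BAND `ē` of the (B2) files.  ph twin with `Ψ(e_K(p − D_{ρ,ϑ,θ}(0)))`.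

* **`bubbleTube_pp_eq_levelIntegral`**, **`bubbleTube_ph_eq_levelIntegral`**.

Measure-theoretic bookkeeping on landed objects; nothing about the model's sizes; nothing asserts superconductivity.  References: FST II CPAM 51 (1998) §3; BGM 2006 §2.4 (2.40)
[cite: BenfattoGiulianiMastropietro2006].
-/

noncomputable section

namespace Summit.HubbardSuperconductivity.HubbardSuperconductivity.Theorems.C4a

set_option linter.dupNamespace false -- summit = problem name (single-conjunct summit), D-0017

open Real Set Filter MeasureTheory
open scoped Topology ContDiff
open Literature.MathematicalPhysics.QuantumLattice Literature.MathematicalPhysics.QuantumLattice.BandSectorCounting Literature.Probability.LatticeModels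
open Summit.HubbardSuperconductivity.HubbardSuperconductivity.Theorems.KLRegimeSplit
open Summit.HubbardSuperconductivity.HubbardSuperconductivity.Theorems.DispersionFlow
open Summit.HubbardSuperconductivity.HubbardSuperconductivity.Theorems.PerturbedFermiCurve

section Rep

variable {a b : ℝ} (B : BandBounds a b) {K : TrigPolyC4v} {A : ℝ}
  (hA : ∀ p : Momentum, ∀ j ≤ 2, ‖iteratedFDeriv ℝ j (frameShift K) p‖ ≤ A) (hADt : 2 * A < B.Dtmin)
  {μ r : ℝ} (hlo : a < μ - r - A) (hhi : μ + r + A < b)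
include B hA hADt hlo hhi

omit B hA hADt hlo hhi in
/-- The loop-angle integral recentred at the base angle: `∫_{(0,2π]} J(e,ϑ)·G(Φ(e,ϑ)) dϑ = ∫_{(−π,π)} J(e,φ+θ)·G(Φ(e,φ+θ)) dφ`. -/
theorem tubeAngular_recentre (G : Momentum → ℂ) (e θ : ℝ) :
    ∫ ϑ in Ioc 0 (2 * π), levelChartJac μ K (e, ϑ) • G (levelPoint μ K e ϑ) =
      ∫ φ in Ioo (-π) π, levelChartJac μ K (e, φ + θ) • G (levelPoint μ K e (φ + θ)) := by
  have hper : Function.Periodic (fun ϑ => levelChartJac μ K (e, ϑ) • G (levelPoint μ K e ϑ)) (2 * π) := fun ϑ => by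
    simp only [levelChartJac_periodic μ K e ϑ, levelPoint_add_two_pi]
  rw [setIntegral_Ioc_two_pi_eq_recentre hper θ]
  refine setIntegral_congr_fun measurableSet_Ioo fun φ _ => ?_
  simp only [add_comm θ φ]

/-- **THE TUBE PIECE OF THE CO-MOVING pp BUBBLE AS A LEVEL INTEGRAL**: for a smooth level profile `f` supported in `(−r, r)` and a smooth `Ψ`,
`∫_{tube} f(e_K(p))·Ψ(e_K(S_{ρ,ϑ,θ}(0) − p)) dp = ∫_{(−r,r)} f(e)·∫_{(−π,π)} J(e,φ+θ)·Ψ(e_K(S_{ρ,ϑ,θ}(0) − Φ(e,φ+θ))) dφ de` — the base angle `θ` enters only through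
the Jacobian `J(e, φ+θ)` and the partner band. -/
theorem bubbleTube_pp_eq_levelIntegral {f : ℝ → ℂ} (hf : ContDiff ℝ ∞ f) (hfsupp : tsupport f ⊆ Ioo (-r) r) {Ψ : ℝ → ℂ} (hΨ : ContDiff ℝ ∞ Ψ)
    (ρ ϑ θ : ℝ) :
    ∫ q in {q : ℝ × ℝ | |q.1| < π ∧ |q.2| < π ∧ |frameLevel μ K (WithLp.toLp 2 ![q.1, q.2])| < r},
        f (frameLevel μ K (WithLp.toLp 2 ![q.1, q.2])) * Ψ (frameLevel μ K (pairSumPath μ K ρ ϑ θ 0 - WithLp.toLp 2 ![q.1, q.2])) =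
      ∫ e in Ioo (-r) r, f e * ∫ φ in Ioo (-π) π,
        levelChartJac μ K (e, φ + θ) • Ψ (frameLevel μ K (pairSumPath μ K ρ ϑ θ 0 - levelPoint μ K e (φ + θ))) := by
  have hV : ContDiff ℝ ∞ fun x : Momentum × Momentum => Ψ (frameLevel μ K (pairSumPath μ K ρ ϑ θ 0 - x.2)) :=
    hΨ.comp ((EngineV8.contDiff_frameLevel μ K).comp (contDiff_const.sub contDiff_snd))
  have h := tubeTadpole_eq_setIntegral_angularAvg B hA hADt hlo hhi hf hfsupp (V := fun _ q => Ψ (frameLevel μ K (pairSumPath μ K ρ ϑ θ 0 - q))) hV θ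
  rw [h]
  refine setIntegral_congr_fun measurableSet_Ioo fun e _ => ?_
  rw [tubeAngularAvg_apply, tubeAngular_recentre (fun q => Ψ (frameLevel μ K (pairSumPath μ K ρ ϑ θ 0 - q))) e θ]

/-- **THE TUBE PIECE OF THE CO-MOVING ph BUBBLE AS A LEVEL INTEGRAL**: the same with the partner `p − D_{ρ,ϑ,θ}(0)`. -/
theorem bubbleTube_ph_eq_levelIntegral {f : ℝ → ℂ} (hf : ContDiff ℝ ∞ f) (hfsupp : tsupport f ⊆ Ioo (-r) r) {Ψ : ℝ → ℂ} (hΨ : ContDiff ℝ ∞ Ψ)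
    (ρ ϑ θ : ℝ) :
    ∫ q in {q : ℝ × ℝ | |q.1| < π ∧ |q.2| < π ∧ |frameLevel μ K (WithLp.toLp 2 ![q.1, q.2])| < r},
        f (frameLevel μ K (WithLp.toLp 2 ![q.1, q.2])) * Ψ (frameLevel μ K (WithLp.toLp 2 ![q.1, q.2] - pairDiffPath μ K ρ ϑ θ 0)) =
      ∫ e in Ioo (-r) r, f e * ∫ φ in Ioo (-π) π,
        levelChartJac μ K (e, φ + θ) • Ψ (frameLevel μ K (levelPoint μ K e (φ + θ) - pairDiffPath μ K ρ ϑ θ 0)) := by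
  have hV : ContDiff ℝ ∞ fun x : Momentum × Momentum => Ψ (frameLevel μ K (x.2 - pairDiffPath μ K ρ ϑ θ 0)) :=
    hΨ.comp ((EngineV8.contDiff_frameLevel μ K).comp (contDiff_snd.sub contDiff_const))
  have h := tubeTadpole_eq_setIntegral_angularAvg B hA hADt hlo hhi hf hfsupp (V := fun _ q => Ψ (frameLevel μ K (q - pairDiffPath μ K ρ ϑ θ 0))) hV θ
  rw [h]
  refine setIntegral_congr_fun measurableSet_Ioo fun e _ => ?_
  rw [tubeAngularAvg_apply, tubeAngular_recentre (fun q => Ψ (frameLevel μ K (q - pairDiffPath μ K ρ ϑ θ 0))) e θ]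

end Rep

end Summit.HubbardSuperconductivity.HubbardSuperconductivity.Theorems.C4a

end
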